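import Literature.Analysis.FluidPDE.NSEnstrophyPersistence
import Literature.Analysis.FluidPDE.NSFiniteEnergySmoothProofs
import Literature.Analysis.FluidPDE.TaoBoundedTotalSpeedProofs
import Literature.Analysis.FluidPDE.TaoAnnulusAssembly
import HarnessLib

/-!
# Tao (2011/2013), Cor. 11.1 + Cor. 4.3 + Thm. 5.4 (iv): `tao2011_hasBoundedSobolevNormsOn` from
# the nonlinear estimate `Y₆` alone

Bookkeeping file for the named fact `Literature.Analysis.FluidPDE.tao2011_hasBoundedSobolevNormsOn`
(`TaoLocalisation.lean`: a finite energy classical solution of the unforced Navier–Stokes system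
on a closed slab `[0, T] × ℝ³` with Schwartz datum has all `L²` Sobolev norms bounded on `[0, T]`;
Tao 2011, Cor. 11.1 + Cor. 4.3 + Thm. 5.4 (iv)). The tree's theorems

* `tao2011_hasBoundedSobolevNormsOn_of_apriori_leaves :
    tao_finite_energy_smooth_energy_bound → tao2011_boundedTotalSpeed →
    tao2011_enstrophyLocalisation_exterior_apriori → tao2011_hasBoundedSobolevNormsOn`
  (`NSEnstrophyPersistence.lean`; the Fourier step of Cor. 11.1, the persistence of `H¹`
  regularity and Cor. 4.3/Thm. 5.4 (iv) for the vendored class are proved there),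
* the discharges `tao_finite_energy_smooth_energy_bound_holds` (Lemma 8.1,
  `NSFiniteEnergySmoothProofs.lean`) and `tao2011_boundedTotalSpeed_holds` (Prop. 9.1,
  `TaoBoundedTotalSpeedProofs.lean`),
* `tao2011_enstrophyLocalisation_exterior_apriori_of_annulus_unit` (Remark 10.6, monotone
  convergence + the `ν = 1 → ν > 0` rescaling, `TaoEnstrophyLocalisationAnnulus.lean`), and
* `tao2011_enstrophyLocalisation_annulus_apriori_unit_of_nonlinearEstimate` (the §10 argument,
  Thm. 10.1 in the annular a priori form of Remark 10.6, from the single static estimate for `Y₆`;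
  `TaoAnnulusAssembly.lean`)

compose to

* `tao2011_hasBoundedSobolevNormsOn_of_nonlinearEstimate :
    tao2011_nonlinearEstimate → tao2011_hasBoundedSobolevNormsOn`.

Thus the fact rests on exactly **one** named fact of standard content, Tao's estimate
(10.19)–(10.23) for the nonlinear term `Y₆` (`TaoNonlinearEstimate.lean`; Whitney decomposition,
local Biot–Savart law, Sobolev/Poincaré on balls, parent-ball chaining), sharpening the two-leaf
forms `…_of_nonlinearEstimate_of_almostRegular` / `…_of_leray` of
`TaoEnstrophyLocalisationLeaves.lean` (which pair `Y₆` with a local `H¹` theory, needed there for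
Prop. 9.1; here Prop. 9.1 is the tree's unconditional theorem).

## Mathlib / tree search

`lean search 'hasBoundedSobolevNormsOn_of_nonlinearEstimate'`: only the two-leaf forms of
`TaoEnstrophyLocalisationLeaves.lean`; no one-leaf form.

## References

* T. Tao, *Localisation and compactness properties of the Navier–Stokes global regularity
  problem*, Anal. PDE 6 (2013) 25–107 = arXiv:1108.1165 (`Tao2011`): Cor. 11.1, Cor. 4.3,
  Thm. 5.4 (iv), Lemma 8.1, Prop. 9.1, Thm. 10.1 + Remark 10.6, and the proof of Thm. 10.1
  (§10, the term `Y₆`).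
-/

noncomputable section

namespace Literature.Analysis.FluidPDE

/-- **`tao2011_hasBoundedSobolevNormsOn` from the nonlinear estimate `Y₆` alone** (Tao 2011,
Cor. 11.1 + Cor. 4.3 + Thm. 5.4 (iv), through Thm. 10.1 / Remark 10.6 in a priori form; every
other input — Lemma 8.1, Prop. 9.1, the §10 bookkeeping, the monotone-convergence and rescaling
passages, the Fourier step of Cor. 11.1, the persistence of regularity — is proved in the tree). [cite: Tao2011, Cor. 11.1 + Cor. 4.3 + Thm. 5.4 (iv) + Thm. 10.1 (proof, Y₆)] -/
theorem tao2011_hasBoundedSobolevNormsOn_of_nonlinearEstimate (hY : tao2011_nonlinearEstimate) :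
    tao2011_hasBoundedSobolevNormsOn :=
  tao2011_hasBoundedSobolevNormsOn_of_apriori_leaves tao_finite_energy_smooth_energy_bound_holds
    tao2011_boundedTotalSpeed_holds
    (tao2011_enstrophyLocalisation_exterior_apriori_of_annulus_unit
      (tao2011_enstrophyLocalisation_annulus_apriori_unit_of_nonlinearEstimate hY))

end Literature.Analysis.FluidPDE

end
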